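import Summits.AtomisticToContinuum.Crystallization.Theorems.FrustratedLawDichotomyCellMasterScale
import Summits.AtomisticToContinuum.Crystallization.Theorems.FrustratedLawDichotomyCellF1cRow
import Summits.AtomisticToContinuum.Crystallization.Theorems.FrustratedLawDichotomyCellF1cHostLin
import Summits.AtomisticToContinuum.Crystallization.Theorems.FrustratedLawDichotomyCellF1cDebit
import Summits.AtomisticToContinuum.Crystallization.Theorems.FrustratedLawDichotomyCellF1cPos
import Summits.AtomisticToContinuum.Crystallization.Theorems.FrustratedLawDichotomyCellF1Far

/-!
# FrustratedLawDichotomy · crux `AperiodicFrustratedLawGap` (stmt-AtomisticToContinuum-27623) — class-A K-file tower, layer 8c: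
# ★★ THE F1 FLOOR — THE ONE CALL OF THE LABELS-SCALE MASTER over the COMPLETE template `MF1c`, MODULO THE NASH NEAR COLUMN
# (decomp-a2c hand-2 g49, structural share «reduce to the most general landed lemma, then specialise»; critic r1849 (A)(2) chain
#  «Near → RM → SY → ONE `lb_le_certFloorL_scale` application = the F1 (228) triple», r1856 (B), r1861 (E4))

hand-1's (251′) `…CellMasterScale.lb_le_certFloorL_scale` is the exact hypothesis list a class-A Floor file discharges.  The F1c tower (#103–#119,
hand-2 g47/g48) typed every STRUCTURAL hypothesis over `MF1c` by name; this file makes THE CALL, discharging in addition — with no census table —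
the four «small» data columns, so that EXACTLY ONE hypothesis remains, the NASH near column:

* `yb` / `SY` (interior norm witnesses): `‖posL F (omF1 x)‖ ≤ ybQ x := (fcWit (rep16 x)).1` for all 403 interior labels (ONE `decide +kernel` over
  `intF1` of `(1+3ε)·|omZ x/2²⁴|² ≤ yb²` + hand-1 `norm_posL_le_ratWitness`); `SYQ := Σ_{intF1} ybQ`;
* `hf` (host-force pairing tail at the constant dial `Lh = 9`, licensed by #114 `nine_le_RwF1c_sub` + #90 `norm_MI_le`):
  `hfZ x := ⌈ybQ x·⌈2⁴⁰·psiTail(7/10, 9)⌉⌉`;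
* `fc` := #102 `fcTabQ (rep16 m)` BY NAME (`hfc_F1`); `deb` := #100/#117 `debF1` BY NAME (`hdeb_F1c`, fold `deb_sum_eq_c`); `host` := #109 `hostLc F` BY NAME
  (`hhost_F1cL`, ★ `hostLin_sum_gec`: `Σ ≥ H3c`);
* ★ `RM` — THE STAR TABLE with NO pair data: difference key `m' ↦ m' − x`, `D := (ballL MF1 zT 23 0) ∖ 0` (the 224 parity vectors
  `0 < |d|² < 23`, = the debit list), `g d := forceRemHiZ 2⁴⁰ (rloQF d) (rhiQF d) (1/512) / 2⁴⁰` read at #99's rational class windows of the DIFFERENCE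
  label (a Bravais template: `aF1 m' − aF1 x = aF1 (m' − x)`), `hwg` by hand-1 `rmWeight_le_reading`; side facts `1/512 < rloQF d ∧ 0 ≤ forceRemHiZ …`
  by ONE `decide +kernel` over `ballF1' 23 0`;
* the four truncation tails and `tailCol 13` EXACT in `ℚ` (hand-1 `…ArithTails` casts, `le_tailColHiZ`).
DIALS OF RECORD (census F1-WIDTH-56 / ATLAS-ED2 §2, integer radii at F1's Gershgorin constant `2/5`): `τ = 2⁻¹⁰`, `Rc = 13`, `δ = 7/10`, `ℓ_A = 40`
(#114), `ℓ_n = ℓ_D = ℓ_r = 23 ↔ L_N = L_D = L_R = 3`, `ℓ_N = 124 ↔ R_N = 7` (`(√40 + √23)² ≤ 124`: the NASH list must see every near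
partner of the interior — `A = 633/100`, `B = 4796/1000`), `R_w = RwF1c = 13 + 2⁻¹⁰`, `Lh ≡ 9`.  |MNc| = 2898, |MLc| = |D| = 224, |MIF1| = 403.

★★ `KF1_le_certFloorL` — for every `F` of the strain cell `BF1` and ANY near column `nnF` certified on `MNc := (ballL MF1c zT 124 0) ∖ 0` with
`Σ_{MNc} nnF ≤ NN`:  `KF1Q − NN/1024 ≤ certFloorL MF1c MIF1 0 (posL F ∘ aF1) (posL F ∘ omF1) 2⁻¹⁰ 13`, where ★ `KF1Q : ℚ` is the CLOSED
rational of all other columns (kernel-evaluable: integer folds over `intF1`, `ballF1' 23 0` and the exact tails; NUMERICALLY (FULL units)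
`KF1Q = −1.425381583` = H3c −1.415457830 − deb 0.000005816 − NASH tails 0.001098281 − hf 0.001654440 − fc 0.000739827 − RM 0.004297923
− tc 0.002127465; so at `cUp = −0.7175` the budget for `NN/1024 + 2·mc` is `0.009618` FULL: break-even `NN ≈ 9.85`, census's Σnn ≈ 2.5–3.5
at `2⁻¹⁰` ⇒ expected `mc ≈ +0.003/root`).  ★★ `certF1c_of_nn` — hence the K-certificate
interface #110 `CertF1c (fun F m => posL F (omF1 m)) cUp mc` from ONE decided inequality `2(cUp + mc) ≤ KF1Q − NN/1024` once the Near file delivers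
`(nnF, NN)`; with #110 `hfloor_KF1c_of_cert` / #119 `hfloor_KF1c_transport` / #120 `…AtlasReachF1` downstream BY NAME.
REMAINING (exact signature = the binder `hnn` below): the NASH near column on the 124-ball — per-representative live blocks (hand-1 `…CellArithNashInt`
/ `…CellArithLipNash`) lifted by #116 `nn_of_reps_aF1c`.
Imports TREE `…CellMasterScale`, #110, #109, #117, #114, #102; 0 sorry.  Tags: [new: K-file layer]; nothing here closes an item.
-/

noncomputable section

namespace Summit.AtomisticToContinuum.Crystallization.Theorems.FrustratedLawDichotomyCellF1cFloor

open Metric Set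
open scoped BigOperators
open Summit.AtomisticToContinuum.Crystallization.Theorems.ChargedEnergyGapNegative (E3)
open Summit.AtomisticToContinuum.Crystallization.Theorems.FrustratedLawDichotomyCoherentFloorAlgebra (psiT forceRem secondNeg energyRem phiT)
open Summit.AtomisticToContinuum.Crystallization.Theorems.FrustratedLawDichotomyCoherentFloor (farCol tailCol)
open Summit.AtomisticToContinuum.Crystallization.Theorems.FrustratedLawDichotomyCellFrame (certFloorL dispL)
open Summit.AtomisticToContinuum.Crystallization.Theorems.FrustratedLawDichotomyCellTails (psiTail linTail remTail debTail certCoeffNearL)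
open Summit.AtomisticToContinuum.Crystallization.Theorems.FrustratedLawDichotomyCellMetric (posL posL_sub posL_neg norm_sq_posL)
open Summit.AtomisticToContinuum.Crystallization.Theorems.FrustratedLawDichotomyCellData (norm_sq_mem_nearId)
open Summit.AtomisticToContinuum.Crystallization.Theorems.FrustratedLawDichotomyCellClasses (ballL ballL_subset)
open Summit.AtomisticToContinuum.Crystallization.Theorems.FrustratedLawDichotomyCellTriples (zT sumT sqT subT zT_sub sumSq_zT mem_ballL_zT sumT_subT)
open Summit.AtomisticToContinuum.Crystallization.Theorems.FrustratedLawDichotomyCellArith (rdHi scHi le_div_of_reading)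
open Summit.AtomisticToContinuum.Crystallization.Theorems.FrustratedLawDichotomyCellArithTaylor (forceRemHiZ tailColQ le_tailColHiZ)
open Summit.AtomisticToContinuum.Crystallization.Theorems.FrustratedLawDichotomyCellArithTails
  (psiTailQ linTailQ remTailQ debTailQ debTail_cast psiTail_cast linTail_cast remTail_cast)
open Summit.AtomisticToContinuum.Crystallization.Theorems.FrustratedLawDichotomyCellArithWitness (norm_posL_le_ratWitness)
open Summit.AtomisticToContinuum.Crystallization.Theorems.FrustratedLawDichotomyCellHostMirror (mirT mirT_mirT norm_mul_psiTail_le_reading)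
open Summit.AtomisticToContinuum.Crystallization.Theorems.FrustratedLawDichotomyCellRemStar (rmWeight_le_reading subT_injOn)
open Summit.AtomisticToContinuum.Crystallization.Theorems.FrustratedLawDichotomyCellFarLabels (hMIA_of_ballL sup_of_ballL_erase)
open Summit.AtomisticToContinuum.Crystallization.Theorems.FrustratedLawDichotomyCellMasterScale (lb_le_certFloorL_scale)
open Summit.AtomisticToContinuum.Crystallization.Theorems.FrustratedLawDichotomyCellStab16 (RZ symOf16 rep16)
open Summit.AtomisticToContinuum.Crystallization.Theorems.FrustratedLawDichotomyCellF1Frame (T qk qk_eq BL admL_iff)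
open Summit.AtomisticToContinuum.Crystallization.Theorems.FrustratedLawDichotomyCellF1Labels (intF1 MF1 MIF1 mem_M sum_MI forall_MI)
open Summit.AtomisticToContinuum.Crystallization.Theorems.FrustratedLawDichotomyCellF1cLabels (MF1c hparc M_subset_Mc MI_subset_Mc)
open Summit.AtomisticToContinuum.Crystallization.Theorems.FrustratedLawDichotomyCellF1Symm (BF1)
open Summit.AtomisticToContinuum.Crystallization.Theorems.FrustratedLawDichotomyCellF1Pos (aF1 aF1_root)
open Summit.AtomisticToContinuum.Crystallization.Theorems.FrustratedLawDichotomyCellF1Interior (norm_MI_le)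
open Summit.AtomisticToContinuum.Crystallization.Theorems.FrustratedLawDichotomyCellF1Windows (loN hiN treeW rlo rhi)
open Summit.AtomisticToContinuum.Crystallization.Theorems.FrustratedLawDichotomyCellF1ClassWin
  (loF1 hiF1 rloF1 rhiF1 hloW_F1 hhiW_F1 rlo_sq_le_F1 hi_le_rhi_sq_F1 rlo_nonneg_F1 rhi_nonneg_F1)
open Summit.AtomisticToContinuum.Crystallization.Theorems.FrustratedLawDichotomyCellF1Lists (ballF1' mem_ballF1' sum_ballL_MF1_erase ballL_MF1_erase_eq)
open Summit.AtomisticToContinuum.Crystallization.Theorems.FrustratedLawDichotomyCellF1Omega (omRep omZ omF1)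
open Summit.AtomisticToContinuum.Crystallization.Theorems.FrustratedLawDichotomyCellF1Far (fcWit fcTabQ hfc_F1)
open Summit.AtomisticToContinuum.Crystallization.Theorems.FrustratedLawDichotomyCellF1Debit (SZ SZ_pos debK debF1 rloQF rhiQF)
open Summit.AtomisticToContinuum.Crystallization.Theorems.FrustratedLawDichotomyCellF1cHostLin (H3c hostLc hhost_F1cL hostLin_sum_gec)
open Summit.AtomisticToContinuum.Crystallization.Theorems.FrustratedLawDichotomyCellF1cHost (RwF1c hadm_F1c hrev_F1c)
open Summit.AtomisticToContinuum.Crystallization.Theorems.FrustratedLawDichotomyCellF1cPos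
  (hsep_aF1c hout_aF1c nine_le_RwF1c_sub MI_subset_ballLc far_aF1c dist_aF1c)
open Summit.AtomisticToContinuum.Crystallization.Theorems.FrustratedLawDichotomyCellF1cNear (ballL_Mc_root_eq ballL_Mc_root_erase_eq sqT_subT_zero qk_le_of_sqT)
open Summit.AtomisticToContinuum.Crystallization.Theorems.FrustratedLawDichotomyCellF1cDebit (hdeb_F1c deb_sum_eq_c)
open Summit.AtomisticToContinuum.Crystallization.Theorems.FrustratedLawDichotomyCellF1cRow (CertF1c)

/-! ## §1 The data of the four small columns and the closed rational `KF1Q` -/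

/-- the NASH near list OF RECORD over the complete template: `(ballL MF1c zT 124 0) ∖ 0` (`ℓ_N = 124 ↔ R_N = 7`). -/
def MNc : Finset (ℤ × ℤ × ℤ) := (ballL MF1c zT 124 (0 : ℤ × ℤ × ℤ)).erase 0

/-- the root-debit list OF RECORD: `(ballL MF1c zT 23 0) ∖ 0` (`ℓ_D = 23 ↔ L_D = 3`). -/
def MLc : Finset (ℤ × ℤ × ℤ) := (ballL MF1c zT 23 (0 : ℤ × ℤ × ℤ)).erase 0

/-- ★ THE STAR TABLE'S KEY SET: the 86 parity differences `0 < |d|² < 23` as OLD labels (`ℓ_r = 23 ↔ L_R = 3`). -/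
def DF1 : Finset (ℤ × ℤ × ℤ) := (ballL MF1 zT 23 (0 : ℤ × ℤ × ℤ)).erase 0

/-- the interior norm witness column: #102's per-representative `yb`, read at the representative. -/
def ybQ (m : ℤ × ℤ × ℤ) : ℚ := (fcWit (rep16 m)).1

/-- the host-force pairing reading of an interior label at the constant dial `Lh = 9`: `⌈yb·⌈2⁴⁰·T0_δ(9)⌉⌉`. -/
def hfZ (m : ℤ × ℤ × ℤ) : ℤ := scHi (ybQ m) (rdHi SZ (psiTailQ (7 / 10) 9))

/-- ★ the star-table reading of a difference class: `forceRemHiZ 2⁴⁰ (rloQF d) (rhiQF d) (2τ)` at #99's rational class window of `d`. -/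
def FRZ (d : ℤ × ℤ × ℤ) : ℤ := forceRemHiZ SZ (rloQF d) (rhiQF d) (1 / 512)

/-- the star-table entry as a real. -/
def gRM (d : ℤ × ℤ × ℤ) : ℝ := ((FRZ d : ℤ) : ℝ) / SZ

/-- `SY`: the interior norm witnesses summed (list fold over `intF1`). -/
def SYQ : ℚ := (intF1.map ybQ).sum

/-- `Σ hf` as an integer fold. -/
def HFZ : ℤ := (intF1.map hfZ).sum

/-- `Σ fc` (#102's readings at representatives) as a rational fold. -/
def FCQ : ℚ := (intF1.map fun m => fcTabQ (rep16 m)).sum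

/-- `Σ_{ML} deb` as #100's integer fold. -/
def DEBZ : ℤ := ((ballF1' 23 0).map debK).sum

/-- `Σ_D g` as an integer fold of the 86 star readings. -/
def RMZ : ℤ := ((ballF1' 23 0).map FRZ).sum

/-- the window tail reading `⌈2⁴⁰·tailCol 13⌉`. -/
def tcZ : ℤ := rdHi SZ (tailColQ 13)

/-- ★★ **THE CLOSED RATIONAL OF THE F1 CELL** (every column except the NASH near sum; FULL units):
host `H3c` − debits − NASH tails − hf − fc − RM − tailCol (`≈ −1.425381583`). -/
def KF1Q : ℚ :=
  H3c - (((DEBZ : ℤ) : ℚ) / SZ + debTailQ (7 / 10) 3 (1 / 1024))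
    - 1 / 1024 * (psiTailQ (7 / 10) 7 + 2 * SYQ * linTailQ (7 / 10) 3)
    - ((HFZ : ℤ) : ℚ) / SZ - FCQ - (SYQ * (((RMZ : ℤ) : ℚ) / SZ) + SYQ * remTailQ (7 / 10) 3 (1 / 1024)) - ((tcZ : ℤ) : ℚ) / SZ

/-! ## §2 The two decided tables -/

/-- the interior norm witnesses dominate: `0 ≤ yb` and `(1 + 3ε)·|omZ x/2²⁴|² ≤ yb²` for all 403 interior labels (ONE kernel decision). -/
theorem yb_cert : ∀ m ∈ intF1, 0 ≤ ybQ m ∧ (1 + 3 * (1 / 1024 : ℚ)) * ∑ i, ((omZ m i : ℚ) / 2 ^ 24) ^ 2 ≤ ybQ m ^ 2 := by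
  decide +kernel

/-- the star table's side facts on the 86 difference classes: `2τ < rlo d` and the reading is nonnegative (ONE kernel decision). -/
theorem D_cert : ∀ d ∈ ballF1' 23 0, (1 / 512 : ℚ) < rloQF d ∧ 0 ≤ FRZ d := by
  decide +kernel

/-! ## §3 Small structural facts -/

/-- the root label vector vanishes. -/
theorem zT_root : zT (0 : ℤ × ℤ × ℤ) = 0 := by
  funext i; fin_cases i <;> rfl

/-- the named column is additive in the label: `aF1 (m' − x) = aF1 m' − aF1 x` (Bravais template). -/
theorem aF1_subT (m' x : ℤ × ℤ × ℤ) : aF1 (subT m' x) = aF1 m' - aF1 x := by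
  have e : (fun j => (zT (subT m' x) j : ℝ)) = (fun j => (zT m' j : ℝ)) - fun j => (zT x j : ℝ) := by
    funext j; simp only [Pi.sub_apply, ← zT_sub]; push_cast; ring
  show T.mulVec _ = T.mulVec _ - T.mulVec _
  rw [e, Matrix.mulVec_sub]

/-- `subT m' x = 0 ⇒ m' = x`. -/
theorem eq_of_subT_eq_zero {m' x : ℤ × ℤ × ℤ} (h : subT m' x = 0) : m' = x := by
  obtain ⟨a, b, c⟩ := m'
  obtain ⟨a', b', c'⟩ := x
  simp only [subT, Prod.mk_eq_zero, sub_eq_zero] at h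
  obtain ⟨rfl, rfl, rfl⟩ := h
  rfl

/-- a parity vector with `|d|² < 23` is an OLD label (`qk ≤ 137 030 436·|d|² ≤ BL`). -/
theorem mem_M_of_small {d : ℤ × ℤ × ℤ} (hpar : Even (sumT d)) (hs : sqT d < 23) : d ∈ MF1 := by
  refine mem_M.mpr ((admL_iff d).mpr ⟨hpar, ?_⟩)
  have hq := qk_le_of_sqT d
  unfold BL
  nlinarith

/-- ★ `hD`: the difference of an interior label and a near partner (radius `23`) is a key of the star table. -/
theorem subT_mem_DF1 {x m' : ℤ × ℤ × ℤ} (hx : x ∈ MIF1) (hm' : m' ∈ MF1c) (hne : m' ≠ x) (hn : m' ∈ ballL MF1c zT 23 x) :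
    subT m' x ∈ DF1 := by
  have hs : sqT (subT m' x) < 23 := ((mem_ballL_zT).mp hn).2
  have hpar : Even (sumT (subT m' x)) := by
    rw [sumT_subT]; exact (hparc m' hm').sub (hparc x (MI_subset_Mc hx))
  refine Finset.mem_erase.mpr ⟨fun h => hne (eq_of_subT_eq_zero h), ?_⟩
  rw [mem_ballL_zT]
  exact ⟨mem_M_of_small hpar hs, by rw [sqT_subT_zero]; exact hs⟩

/-- keys of the star table are members of the decided list. -/
theorem mem_list_of_mem_DF1 {d : ℤ × ℤ × ℤ} (hd : d ∈ DF1) : d ∈ ballF1' 23 0 := by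
  have h := hd
  rw [DF1, ballL_MF1_erase_eq, List.mem_toFinset] at h
  exact h

/-- the rational brackets of #100 are the real brackets of #98 (same table, same code). -/
theorem rloQF_cast (m : ℤ × ℤ × ℤ) : ((rloQF m : ℚ) : ℝ) = rloF1 m := by
  unfold rloQF rloF1 rlo; push_cast; ring

/-- idem, upper bracket. -/
theorem rhiQF_cast (m : ℤ × ℤ × ℤ) : ((rhiQF m : ℚ) : ℝ) = rhiF1 m := by
  unfold rhiQF rhiF1 rhi; push_cast; ring

/-- the real multiplier column is the cast of the rational column `omZ/2²⁴`. -/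
theorem omF1_cast (m : ℤ × ℤ × ℤ) (i : Fin 3) : omF1 m i = (((omZ m i : ℚ) / 2 ^ 24 : ℚ) : ℝ) := by
  unfold omF1; push_cast; ring

/-! ## §4 ★★ THE CALL -/

/-- ★★ **THE F1 FLOOR MODULO THE NASH NEAR COLUMN.**  For every strain `F` of the cell `BF1` and any near column `nnF` certified on the NASH list of record
`MNc` with sum `≤ NN`:  `KF1Q − NN/1024 ≤ certFloorL MF1c MIF1 0 (posL F ∘ aF1) (posL F ∘ omF1) 2⁻¹⁰ 13` — ONE call of hand-1's labels-scale
master with every other column discharged by name or decided in this file. [new: K-file layer] -/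
theorem KF1_le_certFloorL (F : Matrix (Fin 3) (Fin 3) ℝ) (hF : F ∈ BF1) (nnF : ℤ × ℤ × ℤ → ℝ) (NN : ℝ)
    (hnn : ∀ m ∈ MNc, ‖psiT (‖posL F (aF1 m)‖ ^ 2) • posL F (aF1 m)
      - certCoeffNearL MF1c MIF1 (fun x => posL F (aF1 x)) (fun x => posL F (omF1 x)) (ballL MF1c zT 23) m‖ ≤ nnF m)
    (hNN : ∑ m ∈ MNc, nnF m ≤ NN) :
    ((KF1Q : ℚ) : ℝ) - 1 / 1024 * NN ≤ certFloorL MF1c MIF1 0 (fun m => posL F (aF1 m)) (fun m => posL F (omF1 m)) (1 / 1024) 13 := by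
  have hG : ∀ i j, |(F.transpose * F) i j - (if i = j then 1 else 0)| ≤ 1 / 1024 := hF
  have hSZ : (0 : ℤ) < SZ := SZ_pos
  have hSR : (0 : ℝ) < (SZ : ℝ) := by exact_mod_cast hSZ
  -- interior norm witnesses
  have hyb : ∀ x ∈ MIF1, ‖posL F (omF1 x)‖ ≤ ((ybQ x : ℚ) : ℝ) := by
    intro x hx
    have hc := forall_MI.mpr yb_cert x hx
    exact norm_posL_le_ratWitness (εq := 1 / 1024) hG (by norm_num) (vq := fun i => (omZ x i : ℚ) / 2 ^ 24) (omF1_cast x) hc.1 hc.2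
  -- host-force pairing tail at `Lh = 9`
  have hhf : ∀ m ∈ MIF1, ‖posL F (omF1 m)‖ * psiTail (7 / 10 : ℝ) ((fun _ => (9 : ℝ)) m) ≤ ((hfZ m : ℤ) : ℝ) / SZ := by
    intro m hm
    have h := norm_mul_psiTail_le_reading (S := SZ) (yb := ybQ m) (δ := 7 / 10) (Lh := 9) hSZ (norm_nonneg _) (hyb m hm) (by norm_num)
      (by norm_num)
    have e1 : (((7 / 10 : ℚ)) : ℝ) = 7 / 10 := by norm_num
    have e2 : (((9 : ℚ)) : ℝ) = 9 := by norm_num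
    rw [e1, e2] at h
    exact h
  have hLw : ∀ m ∈ MIF1, (fun _ => (9 : ℝ)) m + ‖posL F (aF1 m)‖ ≤ RwF1c := by
    intro m hm
    have h4 := norm_MI_le hG m hm
    have h9 := nine_le_RwF1c_sub
    show (9 : ℝ) + ‖posL F (aF1 m)‖ ≤ RwF1c
    change ‖posL F (aF1 m)‖ ≤ 4 at h4
    linarith
  -- the star-table weight per interior-adjacent pair
  have hwg : ∀ x ∈ MIF1, ∀ m' ∈ MF1c, m' ≠ x → m' ∈ ballL MF1c zT 23 x →
      forceRem ‖posL F (aF1 x) - posL F (aF1 m')‖ (dispL (0 : ℤ × ℤ × ℤ) (1 / 1024 : ℝ) x + dispL 0 (1 / 1024) m')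
        ≤ gRM (subT m' x) := by
    intro x hx m' hm' hne hn
    have hd := subT_mem_DF1 hx hm' hne hn
    have hdM : subT m' x ∈ MF1 := ballL_subset _ _ _ _ (Finset.mem_erase.mp hd).2
    have hfacts := D_cert _ (mem_list_of_mem_DF1 hd)
    have enorm : ‖posL F (aF1 x) - posL F (aF1 m')‖ = ‖posL F (aF1 (subT m' x))‖ := by
      rw [aF1_subT, posL_sub, norm_sub_rev]
    have hsq := norm_sq_mem_nearId hG (aF1 (subT m' x))
    have h1 : ((rloQF (subT m' x) : ℚ) : ℝ) ≤ ‖posL F (aF1 x) - posL F (aF1 m')‖ := by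
      rw [enorm, rloQF_cast]
      refine (pow_le_pow_iff_left₀ (rlo_nonneg_F1 hdM) (norm_nonneg _) two_ne_zero).mp ?_
      exact (rlo_sq_le_F1 hdM).trans ((hloW_F1 _).trans hsq.1)
    have h2 : ‖posL F (aF1 x) - posL F (aF1 m')‖ ≤ ((rhiQF (subT m' x) : ℚ) : ℝ) := by
      rw [enorm, rhiQF_cast]
      refine (pow_le_pow_iff_left₀ (norm_nonneg _) (rhi_nonneg_F1 _) two_ne_zero).mp ?_
      exact hsq.2.trans ((hhiW_F1 _).trans (hi_le_rhi_sq_F1 hdM))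
    have hτ0 : (0 : ℝ) ≤ 1 / 1024 := by norm_num
    have hη₂ : 2 * (1 / 1024 : ℝ) ≤ ((1 / 512 : ℚ) : ℝ) := by norm_num
    exact rmWeight_le_reading (S := SZ) (pos := fun m => posL F (aF1 m)) 0 hτ0 hSZ hη₂ hfacts.1 h1 h2
  -- SY, tc
  have eSY : ∑ x ∈ MIF1, ((ybQ x : ℚ) : ℝ) = ((SYQ : ℚ) : ℝ) := by
    rw [← Rat.cast_sum, sum_MI]; rfl
  have hSY : ∑ x ∈ MIF1, ‖posL F (omF1 x)‖ ≤ ((SYQ : ℚ) : ℝ) := by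
    rw [← eSY]; exact Finset.sum_le_sum hyb
  have htc : tailCol 13 ≤ ((tcZ : ℤ) : ℝ) / SZ := by
    refine le_div_of_reading hSZ ?_
    have := le_tailColHiZ (S := SZ) (R₀ := 13) (R := 13) hSZ.le (by norm_num) (by norm_num); unfold tcZ; exact this
  -- far conversions at the radii of record
  have hfar : ∀ {L : ℝ} {ℓ : ℤ}, L ^ 2 ≤ (1 - 3 * (1 / 1024)) * (2 / 5) * ℓ →
      ∀ m ∈ MF1c, ℓ ≤ ∑ i, zT m i ^ 2 → L ≤ ‖posL F (aF1 m)‖ := by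
    intro L ℓ hL m hm hℓ
    refine far_aF1c hG hL hm fun h => ?_
    have h' := ((mem_ballL_zT).mp h).2
    rw [sqT_subT_zero, ← sumSq_zT] at h'
    exact absurd hℓ (not_le.mpr h')
  -- ★★★ ONE CALL OF THE LABELS-SCALE MASTER
  have h := lb_le_certFloorL_scale (M := MF1c) (MI := MIF1) (pos := fun m => posL F (aF1 m)) (Y := fun m => posL F (omF1 m)) (0 : ℤ × ℤ × ℤ)
    (τ := 1 / 1024) (Rc := 13) (δ := 7 / 10) (L_N := 3) (R_N := 7) (L_D := 3) (L_R := 3)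
    (by norm_num) (by norm_num) (hsep_aF1c hG) MI_subset_Mc
    -- radii of record
    zT (ℓA := 40) (ℓn := 23) (ℓN := 124) (ℓD := 23) (ℓr := 23) (A := 633 / 100) (B := 4796 / 1000)
    (hMIA_of_ballL 0 zT_root MI_subset_ballLc) (by norm_num) (by norm_num) (by norm_num) (by norm_num) (by norm_num) (by norm_num)
    -- NASH lists
    MNc (by norm_num) (by norm_num) (Finset.erase_subset_erase _ (ballL_subset _ _ _ _)) (sup_of_ballL_erase 0 zT_root 124)
    (fun c _ x hx _ hn => dist_aF1c hG (by norm_num) hx hn)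
    (fun m hm h124 => hfar (by norm_num) m hm h124)
    -- debit list
    MLc (by norm_num) (by norm_num) (Finset.erase_subset_erase _ (ballL_subset _ _ _ _)) (sup_of_ballL_erase 0 zT_root 23)
    (fun m hm h23 => hfar (by norm_num) m hm h23)
    -- remainder: star table
    (by norm_num) (by norm_num) (fun m _ m' hm' _ hn => dist_aF1c hG (by norm_num) hm' hn)
    (fun x m' => subT m' x) (fun x _ => subT_injOn x MF1c) DF1 gRM
    (fun d hd => div_nonneg (by exact_mod_cast (D_cert d (mem_list_of_mem_DF1 hd)).2) hSR.le)
    (fun x hx m' hm' hne hn => subT_mem_DF1 hx hm' hne hn) hwg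
    (fun x => ((ybQ x : ℚ) : ℝ)) hyb
    -- host: mirror core
    mirT (hrev_F1c F) (fun m _ m' _ => mirT_mirT m m') (adm := fun x => Even (sumT x)) (R_w := RwF1c) hadm_F1c (hout_aF1c hG)
    (fun _ => (9 : ℝ)) (by intro m _; norm_num) hLw
    -- the certified numbers
    (hostLc F) (hhost_F1cL hG)
    debF1 (hdeb_F1c hG (by norm_num))
    nnF hnn
    (fun m => ((hfZ m : ℤ) : ℝ) / SZ) hhf
    (fun m => ((fcTabQ (rep16 m) : ℚ) : ℝ)) (hfc_F1 F hF)
    ((SYQ : ℚ) : ℝ) hSY (((tcZ : ℤ) : ℝ) / SZ) htc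
  -- the sum identities
  have hH := hostLin_sum_gec hG
  have eDEB : ∑ m ∈ MLc, debF1 m = ((DEBZ : ℤ) : ℝ) / SZ := deb_sum_eq_c (ℓ := 23) (by norm_num)
  have eHF : ∑ m ∈ MIF1, ((hfZ m : ℤ) : ℝ) / SZ = ((HFZ : ℤ) : ℝ) / SZ := by
    rw [← Finset.sum_div, ← Int.cast_sum, sum_MI]; rfl
  have eFC : ∑ m ∈ MIF1, ((fcTabQ (rep16 m) : ℚ) : ℝ) = ((FCQ : ℚ) : ℝ) := by
    rw [← Rat.cast_sum, sum_MI]; rfl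
  have eRM : ∑ d ∈ DF1, gRM d = ((RMZ : ℤ) : ℝ) / SZ := by
    unfold gRM
    rw [← Finset.sum_div, ← Int.cast_sum, DF1, sum_ballL_MF1_erase]; rfl
  rw [eDEB, eHF, eFC, eRM, eSY] at h
  -- exact tails
  have e1 := debTail_cast (7 / 10) 3 (1 / 1024)
  have e2 := psiTail_cast (7 / 10) 7
  have e3 := linTail_cast (7 / 10) 3
  have e4 := remTail_cast (7 / 10) 3 (1 / 1024)
  push_cast at e1 e2 e3 e4
  rw [e1, e2, e3, e4] at h
  refine le_trans ?_ h
  have hτ : (0 : ℝ) ≤ 1 / 1024 := by norm_num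
  unfold KF1Q
  push_cast
  linarith [hH, hNN]

/-- ★★ **THE K-CERTIFICATE OF THE F1 ROW FROM THE NEAR COLUMN.**  An `F`-uniform near column `nnF` on `MNc` with `Σ ≤ NN` and ONE decided inequality
`2·(cUp + mc) ≤ KF1Q − NN/1024` give #110's interface `CertF1c (fun F m => posL F (omF1 m)) cUp mc` — whence the F1 floor #110 `hfloor_KF1c_of_cert`, its
transported form #119 and the one-row reach #120 `coherentMassExclusion_F1c` BY NAME. [new: K-file layer] -/
theorem certF1c_of_nn (nnF : ℤ × ℤ × ℤ → ℝ) (NN : ℚ)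
    (hnn : ∀ F ∈ BF1, ∀ m ∈ MNc, ‖psiT (‖posL F (aF1 m)‖ ^ 2) • posL F (aF1 m)
      - certCoeffNearL MF1c MIF1 (fun x => posL F (aF1 x)) (fun x => posL F (omF1 x)) (ballL MF1c zT 23) m‖ ≤ nnF m)
    (hNN : ∑ m ∈ MNc, nnF m ≤ (NN : ℝ)) {cUp mc : ℚ} (hK : 2 * (cUp + mc) ≤ KF1Q - 1 / 1024 * NN) :
    CertF1c (fun F m => posL F (omF1 m)) cUp mc := by
  intro F hF
  have h := KF1_le_certFloorL F hF nnF NN (hnn F hF) hNN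
  have hK' : ((2 * (cUp + mc) : ℚ) : ℝ) ≤ ((KF1Q - 1 / 1024 * NN : ℚ) : ℝ) := Rat.cast_le.mpr hK
  push_cast at hK'
  exact hK'.trans h

end Summit.AtomisticToContinuum.Crystallization.Theorems.FrustratedLawDichotomyCellF1cFloor

end
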